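import Summits.AtomisticToContinuum.FouriersLaw.Theses.CoercivePulse
import Summits.AtomisticToContinuum.FouriersLaw.Theorems.CoercivePulseLinearCeilingAbelMeanCeiling
import Summits.AtomisticToContinuum.FouriersLaw.Theorems.CoercivePulseLinearCeilingSpectralRepresentation
import Summits.AtomisticToContinuum.FouriersLaw.Theorems.CoercivePulseLinearCeilingHelfandMoment
import Summits.AtomisticToContinuum.FouriersLaw.Theorems.CoercivePulseLinearCeilingEnvelopeOfSpectralAbelBound
import HarnessLib

/-!
# Skeleton of line `SpikeLemma` — crux `CoercivePulse.LinearCeiling` (item stmt-AtomisticToContinuum-15383)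

Line lead prover-line-stmt-AtomisticToContinuum-15383-0, 2026-08-17 (idea cards `subadditive-spike-collapse` /
`abel-inversion-collapse`, reshaped: cosine-Bochner inversion in place of the no-spike lemma).

THE LINE. The crux (a pointwise-in-time, anchored linear upper envelope of the Helfand moment `M(t) = Σ_x x² S(x,t)` of
the averaged equilibrium energy pulse of the pinned anharmonic chain) COLLAPSES onto the route's own child
(R) = `CoercivePulse.UniformAbelianRegularity` (item stmt-AtomisticToContinuum-13416, shared x4, consumed by `closes`):

* `stub_uniformAbelianRegularity` — (R) VERBATIM (the only open content; XL).
* `stub_abelMeanCeiling` — (R) ⇒ the Abel means of the summed current autocorrelation of EVERY guarded pair are bounded,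
  `∫₀^∞ e^(−νt) C_T(t) dt ≤ B` for `ν ∈ (0, ν₀)` (the sibling chain `AbelSpreadCeiling.RegularityCollapse`: (R) at ε = 1 and bath
  constant 1, the landed fixed-frequency open/closed matching `F_N(ν)/N → Â(ν)` for the canonical twin, `abel_bound_of_regularity`).
* `stub_spectralRepresentation` — for EVERY guarded pair, `C_T(t) = ∫ cos(ωt) dσ(ω)` for a finite measure `σ` (landed
  `GreenKuboContinuation.BandLimitedKrylov.stub_canonicalSpectralMeasure` for the canonical pair at bath constant 1 + uniqueness of the
  shift-invariant DLR state + the canonical twin / uniqueness of good orbits: every guarded pair has the canonical `C_T`).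
* `stub_helfandMoment` — Helfand's identity in the time domain, `M(t) − M(0) = 2∫₀ᵗ (t−u) C_T(u) du` (`t > 0`), under the crux's
  own hypothesis `Σ_x (1+x²)|S(x,t)| < ∞` (landed per-site law `stub_perSiteHelfand` + cut-off weights / summation by parts /
  Tannery of the `AbelExchangeToolkit` + the window-uniform clustering majorant of the canonical twin for dominated convergence in `u`).
* `stub_envelopeOfSpectralAbelBound` — PURE REAL ANALYSIS: `C = ∫cos(ωt)dσ` with Abel means `≤ B` on `(0, ν₀)` ⇒
  `2∫₀ᵗ(t−u)C(u)du ≤ b·t` for all `t ≥ 0` (Fubini; `∫₀ᵗ(t−u)cos(ωu)du = (1 − cos ωt)/ω² ≤ 4t·(t⁻¹/(t⁻² + ω²))`, i.e. `≤ 8t·Â(1/t)`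
  for `t > 1/ν₀`; `≤ σ(ℝ)t²` for small `t`).

Composition `LinearCeiling_of`: `b` from the last stub, `t₃ = 0`, and `M(t) = M(0) + 2∫₀ᵗ(t−u)C_T` from Helfand.

STATUS (skeleton v4, 2026-08-17): stubs 2–5 LANDED (p165974, p165986, p166108, p166574) and imported; the ONLY `sorry` left is
stub 1 = (R) = item stmt-AtomisticToContinuum-13416. The sorry-free certificate `linearCeiling_of_uniformAbelianRegularity :
UniformAbelianRegularity → LinearCeiling` is `Theorems/CoercivePulseLinearCeilingOfUniformAbelianRegularity.lean`.

LEAD c1 (2026-08-17, continuation; code of this skeleton unchanged): the crux is now CHARACTERISED —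
`linearCeiling_iff_abelCeiling : LinearCeiling ↔ (AC)` (p172207, `Theorems/CoercivePulseLinearCeilingIffAbelCeiling.lean`),
(AC) = the infinite-volume Abel ceiling `∀ guarded (μ, D), ∃ B ν₀ > 0, ∀ ν ∈ (0, ν₀), ∫₀^∞ e^{−νt} C_T ≤ B` (⇐ over the
stubs of this line; ⇒ by the PROVED `PulseCalculus` + the upper half of the Abelian sandwich), so EVERY supplier of (AC)
closes the crux: (R) via `stub_abelMeanCeiling` (this skeleton), or the window pair of route `LatticeLandauDamping`,
`linearCeiling_of_windowDecomposition_of_noDrudeWeight : WindowDecomposition → NoDrudeWeight → LinearCeiling` (items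
stmt-14011 ∧ stmt-14012; p172217, `Theorems/CoercivePulseLinearCeilingOfWindowDecomposition.lean`). (AC) is the finiteness
half of the conductivity of the infinite pinned anharmonic chain in its weakest (limsup, Abelian) form — open since BLR2000 §7;
no line can owe less. Outcome: blocked-on stmt-AtomisticToContinuum-13416.

LEAD c2 (2026-08-18, continuation; code of this skeleton unchanged): characterisation COMPLETED over landed theorems —
`linearCeiling_iff_abelSpreadCeiling : LinearCeiling ↔ HoelderEscapeProfile.AbelSpreadCeiling` (stmt-16010; p173470,
`Theorems/CoercivePulseLinearCeilingIffAbelSpreadCeiling.lean`, via clause (12) of the proved `FibreCalculus`): the cruxes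
stmt-15383 / stmt-15770 / stmt-16010 are ONE statement; `noDrudeWeight_of_linearCeiling : LinearCeiling →
LatticeLandauDamping.NoDrudeWeight` (stmt-14012; `Theorems/CoercivePulseLinearCeilingNoDrudeWeight.lean`): the crux is at least
the zero-energy-Drude-weight problem; `linearCeiling_iff_spectralCeiling` (`Theorems/CoercivePulseLinearCeilingIffSpectralCeiling.lean`):
LinearCeiling ⇔ every cosine-Bochner current spectral measure of every guarded pair has linear small-ball mass at zero frequency,
`σ[−ε, ε] ≤ Kε` — the canonical spectral form (finite conductivity, weakest `limsup` sense); weakest spectral supplier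
`linearCeiling_of_spectralCeiling`. Still 1 sorry = (R); wave: none — 1 stub left, it is item stmt-13416 with its own lead.
-/

noncomputable section

namespace Summit.AtomisticToContinuum.FouriersLaw.Theorems.LinearCeiling.SpikeLemma

open MeasureTheory Filter Set
open scoped Topology BigOperators

/-- **Stub 1 — (R), VERBATIM item stmt-AtomisticToContinuum-13416 (`CoercivePulse.UniformAbelianRegularity`).** N-uniform Abelian
regularity of the open chain's equilibrium total-current autocorrelation: the low-frequency part carries `o(N)` weight uniformly in
`ν < ν₀(ε)`. The ONLY open content of the line (XL; shared with EmbeddedDrudeMourre / HoelderEscapeProfile / StaticAbelianSqueeze /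
CageBudgetFekete). [cite: BonettoLebowitzReyBellet2000, §7] -/
theorem stub_uniformAbelianRegularity :
    ∀ ω₂ lam β γ : ℝ, 0 < ω₂ → 0 < lam → 0 < β → 0 < γ → ∀ T : ℝ, 0 < T → ∀ ε : ℝ, 0 < ε → ∃ ν₀ : ℝ, 0 < ν₀ ∧ ∀ ν : ℝ, 0 < ν → ν < ν₀ → ∃ N₀ : ℕ, ∀ N : ℕ, N₀ ≤ N → let J : Literature.MathematicalPhysics.KineticTheory.HeatConduction.PhaseSpace N → ℝ := fun z => ∑ i : Fin N, (Literature.MathematicalPhysics.KineticTheory.HeatConduction.pinnedChain ω₂ lam β γ).bondCurrent N i z; |∫ t in Set.Ioi (0:ℝ), (1 - Real.exp (-(ν * t))) * ∫ z, J z * (∫ y, J y ∂((Literature.MathematicalPhysics.KineticTheory.HeatConduction.pinnedChain ω₂ lam β γ).transitionKernel N T T t.toNNReal z)) ∂((Literature.MathematicalPhysics.KineticTheory.HeatConduction.pinnedChain ω₂ lam β γ).gibbsMeasure N T)| ≤ ε * N := by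
  sorry

-- stub_abelMeanCeiling: LANDED (imported) — Theorems/CoercivePulseLinearCeilingAbelMeanCeiling.lean

-- stub_spectralRepresentation: LANDED (imported) — Theorems/CoercivePulseLinearCeilingSpectralRepresentation.lean

-- stub_helfandMoment: LANDED (imported) — Theorems/CoercivePulseLinearCeilingHelfandMoment.lean

-- stub_envelopeOfSpectralAbelBound: LANDED (imported) — Theorems/CoercivePulseLinearCeilingEnvelopeOfSpectralAbelBound.lean

/-- **Composition: the crux `CoercivePulse.LinearCeiling` from the five stubs** (`t₃ = 0`, `b` from stub 5; Helfand's identity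
converts the bound on `2∫₀ᵗ(t−u)C_T` into the anchored envelope of `M`). -/
theorem LinearCeiling_of : _root_.Summit.AtomisticToContinuum.FouriersLaw.Theses.CoercivePulse.LinearCeiling := by
  intro ω₂ lam β γ hω hl hβ T hT μ hG hSI hR D hP hSh h hh S hS hSum
  obtain ⟨B, ν₀, hν₀, hA⟩ :=
    stub_abelMeanCeiling stub_uniformAbelianRegularity ω₂ lam β γ hω hl hβ T hT μ hG hSI hR D hP
  obtain ⟨σ, hσ, hC⟩ := stub_spectralRepresentation ω₂ lam β γ hω hl hβ T hT μ hG hSI hR D hP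
  obtain ⟨b, hb⟩ := stub_envelopeOfSpectralAbelBound σ hσ _ hC B ν₀ hν₀ hA
  refine ⟨b, 0, fun t ht => ?_⟩
  rcases eq_or_lt_of_le ht with h0 | h0
  · subst h0
    simp
  · have hH := stub_helfandMoment ω₂ lam β γ hω hl hβ T hT μ hG hSI hR D hP hSh h hh S hS hSum t h0
    have hbt := hb t ht
    rw [sub_zero]
    linarith

end Summit.AtomisticToContinuum.FouriersLaw.Theorems.LinearCeiling.SpikeLemma

end
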